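import Summits.ResolutionOfSingularities.ResolutionOfSingularities.Theorems.WeightedInvariantIota3RatioLetterExact
import Literature.AlgebraicGeometry.Resolution.PowerSeriesRegularLocal
import HarnessLib

/-!
# The guard `0 < σ₁(f)` in the exactness of the ratio letter is NECESSARY: a regular parameter reaches every triple, its ratio witness set is unbounded,
# and `σ₁ = 0` (door `HypersurfaceCentreConstruction`, stmt-ResolutionOfSingularities-19897; P3 rung; bookkeeping for (R6))

Topic: `Summits/ResolutionOfSingularities/ResolutionOfSingularities/Theorems`. Helper for the door item `HypersurfaceCentreConstruction`
(stmt-ResolutionOfSingularities-19897, route `WeightedInvariant`), line `local-engine`, def-free.  Records in kernel why the gap list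
`keyRungGrHomLE_three_of_idealDescentExactR6` (…Iota3IdealDescentExactR6, p820372) is VACUOUS and the guarded one (…Iota3IdealDescentExactR6Pos, p820412;
discharged in …Iota3RatioLetterExact, p820504) is the right one: in `k⟦X₀, X₁, X₂⟧` the parameter `f = X₀` (order `1`) is carried by the two-flag
`(X₀, X₁)` to EVERY admissible triple, so the ratio witness set `{m | m·r₂ ≤ ν!·r₁, (q; r₁, r₂) reached}` is unbounded, `σ₁(f) = sigmaRatioNat f = 0` by the
`Nat.sSup` convention, and the unguarded inequality `ν!·r₁ ≤ σ₁·r₂` fails at `(1; 1, 1)`.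

* `flagReaches_X_zero` — `X₀` reaches every admissible triple; `sigmaRatioNat_X_zero` — `σ₁(X₀) = 0`;
* **`not_ratioLetterExact_unguarded`** — the unguarded (R6) statement over all regular local rings of dimension three is FALSE.

[OURS · L1 W4.3 · bookkeeping]  Replaces the role of NO printed item; NOT a statement of the manuscript [claim: Hironaka2017, status: under-review];
AI work, weaker than expert review.  No definition; no axiom.
-/

noncomputable section

set_option linter.dupNamespace false -- mandated namespace `Summit.<Summit>.<Problem>` of this single-conjunct summit

open IsLocalRing Literature.AlgebraicGeometry.Resolution
open Summit.ResolutionOfSingularities.ResolutionOfSingularities.Theorems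

namespace Summit.ResolutionOfSingularities.ResolutionOfSingularities.Cruxes.HypersurfaceCentreConstruction.LocalEngine

namespace Iota3

section Witness

variable (k : Type) [Field k]

/-- `dim k⟦X₀, X₁, X₂⟧ = 3` in the `(3 : ℕ)` spelling. [folklore] -/
theorem ringKrullDim_mvPowerSeries_fin_three : ringKrullDim (MvPowerSeries (Fin 3) k) = (3 : ℕ) := by
  rw [ringKrullDim_mvPowerSeries, Nat.card_eq_fintype_card, Fintype.card_fin]

/-- `(X₀, X₁)` is a two-flag of `k⟦X₀, X₁, X₂⟧`. [folklore] -/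
theorem isTwoFlag_X_zero_X_one :
    haveI := isRegularLocalRing_mvPowerSeries k (Fin 3)
    IsTwoFlag (MvPowerSeries.X 0 : MvPowerSeries (Fin 3) k) (MvPowerSeries.X 1) := by
  haveI := isRegularLocalRing_mvPowerSeries k (Fin 3)
  have hd : (maximalIdeal (MvPowerSeries (Fin 3) k)).spanFinrank = 3 :=
    spanFinrank_eq_three_of_ringKrullDim (by rw [ringKrullDim_mvPowerSeries_fin_three]; norm_cast)
  exact isTwoFlag_of_rsp hd (fun i => (MvPowerSeries.X i : MvPowerSeries (Fin 3) k)) (maximalIdeal_mvPowerSeries_eq_span k (Fin 3)).symm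
    (i := 0) (j := 1) (by decide)

/-- **A parameter reaches every admissible triple**: `X₀ ∈ F_{(X₀,X₁)}(q; r₁, r₂)(r₁·1)`. [folklore] -/
theorem flagReaches_X_zero {q : ℕ} (hq : 0 < q) (r₁ r₂ : ℕ) :
    haveI := isRegularLocalRing_mvPowerSeries k (Fin 3)
    FlagReaches (MvPowerSeries.X 0 : MvPowerSeries (Fin 3) k) 1 q r₁ r₂ := by
  haveI := isRegularLocalRing_mvPowerSeries k (Fin 3)
  refine ⟨MvPowerSeries.X 0, MvPowerSeries.X 1, isTwoFlag_X_zero_X_one k, ?_⟩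
  have h := pow_left_mem_flagContactFiltration (g₁ := (MvPowerSeries.X 0 : MvPowerSeries (Fin 3) k)) (g₂ := MvPowerSeries.X 1)
    (r₁ := r₁) (r₂ := r₂) (n := r₁ * 1) (α := 1) hq le_rfl
  rwa [pow_one] at h

/-- `ord X₀ = 1`. [folklore] -/
theorem adicOrder_X_zero_toNat :
    haveI := isRegularLocalRing_mvPowerSeries k (Fin 3)
    (adicOrder (MvPowerSeries.X 0 : MvPowerSeries (Fin 3) k)).toNat = 1 := by
  haveI := isRegularLocalRing_mvPowerSeries k (Fin 3)
  have hfl := isTwoFlag_X_zero_X_one k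
  rw [(adicOrder_eq_one_iff _).mpr ⟨hfl.1, hfl.left_not_mem_sq⟩]
  rfl

/-- **`σ₁(X₀) = 0`**: the ratio witness set of a parameter is unbounded (`(1; N, 1)` is reached for every `N`), and `Nat.sSup` of an unbounded set is `0`.
[folklore] -/
theorem sigmaRatioNat_X_zero :
    haveI := isRegularLocalRing_mvPowerSeries k (Fin 3)
    sigmaRatioNat (MvPowerSeries.X 0 : MvPowerSeries (Fin 3) k) = 0 := by
  haveI := isRegularLocalRing_mvPowerSeries k (Fin 3)
  have hnb : ¬ BddAbove {m : ℕ | ∃ q r₁ r₂ : ℕ, AdmissibleTriple q r₁ r₂ ∧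
      FlagReaches (MvPowerSeries.X 0 : MvPowerSeries (Fin 3) k) (adicOrder (MvPowerSeries.X 0 : MvPowerSeries (Fin 3) k)).toNat q r₁ r₂ ∧
      m * r₂ ≤ ratioScale (adicOrder (MvPowerSeries.X 0 : MvPowerSeries (Fin 3) k)).toNat * r₁} := by
    rintro ⟨N, hN⟩
    have hmem : N + 1 ∈ {m : ℕ | ∃ q r₁ r₂ : ℕ, AdmissibleTriple q r₁ r₂ ∧
        FlagReaches (MvPowerSeries.X 0 : MvPowerSeries (Fin 3) k) (adicOrder (MvPowerSeries.X 0 : MvPowerSeries (Fin 3) k)).toNat q r₁ r₂ ∧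
        m * r₂ ≤ ratioScale (adicOrder (MvPowerSeries.X 0 : MvPowerSeries (Fin 3) k)).toNat * r₁} := by
      refine ⟨1, N + 1, 1, ⟨Nat.one_pos, le_rfl, Nat.succ_pos N⟩, ?_, ?_⟩
      · rw [adicOrder_X_zero_toNat]; exact flagReaches_X_zero k Nat.one_pos _ _
      · rw [adicOrder_X_zero_toNat]; unfold ratioScale; simp
    have := hN hmem
    omega
  unfold sigmaRatioNat
  rw [csSup_of_not_bddAbove hnb, csSup_empty, bot_eq_zero]

end Witness

/-- **THE UNGUARDED EXACTNESS STATEMENT IS FALSE**: «for every regular local ring of dimension three and every `f ∈ 𝔪 ∖ 0`, every reached admissible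
triple has `ν!·r₁ ≤ σ₁(f)·r₂`» fails at `k⟦X₀,X₁,X₂⟧`, `f = X₀`, `(1; 1, 1)` (`1 ≤ 0`).  Hence the hypothesis `hR6` of `keyRungGrHomLE_three_of_idealDescentExactR6`
(p820372) is unsatisfiable and that gap list is vacuous; the guarded form (`0 < σ₁(f)`, …Iota3IdealDescentExactR6Pos) is the correct one and is PROVED in
…Iota3RatioLetterExact. [OURS · L1 W4.3 · bookkeeping] -/
theorem not_ratioLetterExact_unguarded :
    ¬ (∀ (T : Type) [CommRing T] [IsRegularLocalRing T] (f : T), ringKrullDim T = (3 : ℕ) → f ≠ 0 → f ∈ maximalIdeal T →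
      ∀ q r₁ r₂ : ℕ, AdmissibleTriple q r₁ r₂ → FlagReaches f (adicOrder f).toNat q r₁ r₂ →
      ratioScale (adicOrder f).toNat * r₁ ≤ sigmaRatioNat f * r₂) := by
  intro h
  haveI := isRegularLocalRing_mvPowerSeries ℚ (Fin 3)
  have hfl := isTwoFlag_X_zero_X_one ℚ
  have hf0 : (MvPowerSeries.X 0 : MvPowerSeries (Fin 3) ℚ) ≠ 0 := fun h0 =>
    hfl.left_not_mem_sq (by rw [h0]; exact Ideal.zero_mem _)
  have h1 := h (MvPowerSeries (Fin 3) ℚ) (MvPowerSeries.X 0) (ringKrullDim_mvPowerSeries_fin_three ℚ) hf0 hfl.1 1 1 1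
    ⟨Nat.one_pos, le_rfl, le_rfl⟩ (by rw [adicOrder_X_zero_toNat]; exact flagReaches_X_zero ℚ Nat.one_pos 1 1)
  rw [sigmaRatioNat_X_zero, adicOrder_X_zero_toNat] at h1
  unfold ratioScale at h1
  simp at h1

end Iota3

end Summit.ResolutionOfSingularities.ResolutionOfSingularities.Cruxes.HypersurfaceCentreConstruction.LocalEngine

end
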